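import Literature.AlgebraicGeometry.Frobenioids.IrreducibleMorphismsChains
import Literature.AlgebraicGeometry.Frobenioids.IrreducibleMorphismsCounterexample
import Literature.AlgebraicGeometry.Frobenioids.CoAngularPreSteps
import Mathlib.Data.Nat.Prime.Infinite
import HarnessLib

/-!
# Frobenioids I, Proposition 1.14 (iii): the repaired biconditional (R1)

Mochizuki, *The geometry of Frobenioids I: the general theory*, Kyushu J. Math. **62** (2008)
293–400, §1, Proposition 1.14 (iii) and its proof, kurims text pp. 41–43
[cite: MochizukiFrdI2008, Prop. 1.14]. Standing data: `Φ` a divisorial monoid on a connected,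
totally epimorphic category `D`; `C → F_Φ` a Frobenioid (`hF`) of isotropic type (`hist`); `D` of
FSMFF-type (`hD`).

This file PROVES the repaired reading `NonPreStepIffBoundedFSMIChainsOfFSMI` (R1, ours — typed in
`IrreducibleMorphismsCounterexample.lean` next to the false-as-typed printed statement): under the
extra hypothesis that prime-Frobenius morphisms of `C` are FSMI-morphisms, an irreducible `φ` is a
non-pre-step iff the lengths of the expressions of the `ψ ∘ φ` (`ψ` FSMI) as composites of
FSMI-morphisms are bounded. "⟹" is `exists_chain_bound_of_not_isPreStep` (no extra hypothesis);
"⟸" follows the printed argument (p. 42): for an irreducible pre-step `φ` (a step with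
irreducible zero divisor `x`, by (i)) and a prime-Frobenius `ψ` of degree `p`, Prop. 1.10 (ii)
rewrites `ψ ∘ φ = φ′ ∘ ψ′` with `ψ′` prime-Frobenius of degree `p` and `φ′` a pre-step with
`Div(φ′) = p · ψ′_*(x)`, which by Def. 1.3 (iii)(d) is a composite of `p` steps with irreducible
zero divisor — FSMI-morphisms by (i) and Prop. 1.11 (vii); with `ψ′` FSMI (the extra hypothesis)
this is a chain of length `p + 1`, unbounded in `p`.
-/

namespace Literature.AlgebraicGeometry.Frobenioids

open CategoryTheory Opposite

universe w v v' u u'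

namespace PreFrobenioid

variable {D : Type u} [Category.{v} D] {Φ : Dᵒᵖ ⥤ CommMonCat.{w}}
  {C : Type u'} [Category.{v'} C] (F : C ⥤ ElemFrobenioid Φ)

/-- A step with irreducible zero divisor is an FSMI-morphism [(i); Prop. 1.11 (vii)] — in a
Frobenioid of isotropic type. [cite: MochizukiFrdI2008, Prop. 1.14(iii) p.42] -/
theorem isFSMI_of_isPreStep_of_isIrreducibleElt (hF : IsFrobenioid F) (hist : IsOfIsotropicType F)
    {X Y : C} {σ : X ⟶ Y} (hσ : IsPreStep F σ) (hz : IsIrreducibleElt (Div F σ)) : IsFSMI σ := by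
  have hP := hF.isPreFrobenioid
  have hstep : IsStep F σ := ⟨hσ, fun h => hz.1 (isIsometry_of_isIso F hP σ)⟩
  exact ⟨IsCoAngularPreStep.isFSM hF ⟨isCoAngular_of_isOfIsotropicType F hist σ, hσ⟩,
    isIrreducibleHom_of_isStep F hP hist hstep hz⟩

/-- A pre-step whose zero divisor is the `(k+1)`-st power of an irreducible element is a composite
of `k + 1` FSMI-morphisms (steps with irreducible zero divisor, split off one at a time by the
equivalence `^X(C^coa-pre) ⥲ Order(Φ(X))` of Def. 1.3 (iii)(d)) — in a Frobenioid of isotropic type.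
[cite: MochizukiFrdI2008, Prop. 1.14(iii) p.42] -/
theorem isFSMIChain_of_div_eq_pow (hF : IsFrobenioid F) (hist : IsOfIsotropicType F) :
    ∀ (k : ℕ) {X Y : C} (γ : X ⟶ Y) (z : Φ.obj (op (baseObj F X))), IsIrreducibleElt z →
      IsPreStep F γ → Div F γ = z ^ (k + 1) → IsFSMIChain γ (k + 1) := by
  have hP := hF.isPreFrobenioid
  intro k
  induction k with
  | zero =>
    intro X Y γ z hz hγ hd
    rw [zero_add, pow_one] at hd
    exact IsFSMIChain.single _ (isFSMI_of_isPreStep_of_isIrreducibleElt F hF hist hγ (hd ▸ hz))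
  | succ k ih =>
    intro X Y γ z hz hγ hd
    haveI : IsCancelMul (Φ.obj (op (baseObj F X))) :=
      isIntegral_iff_isCancelMul.mp (hP.isDivisorial (baseObj F X)).isPreDivisorial.isIntegral
    -- split off a step `σ : X → X₁` with `Div(σ) = z`
    obtain ⟨X₁, σ, hσ, hσz⟩ := hF.iii_d_under_surj X z
    obtain ⟨γ', hγ', hfac⟩ := hF.iii_d_under_full σ γ hσ
      ⟨isCoAngular_of_isOfIsotropicType F hist γ, hγ⟩
      (by rw [hσz, hd]; exact dvd_pow_self z (Nat.succ_ne_zero _))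
    haveI : IsIso (Base F σ) := hσ.2.2
    -- `Div(γ') = z' ^ (k+1)` with `z' = (σ^*)⁻¹ z` irreducible
    have h1 : pull Φ (Base F σ) (Div F γ') = z ^ (k + 1) := by
      have h2 : Div F γ = pull Φ (Base F σ) (Div F γ') * Div F σ := by
        rw [← hfac, div_comp, show degFr F γ' = 1 from hγ'.2.1, PNat.one_coe, pow_one]
      rw [hd, hσz, pow_succ] at h2
      exact (mul_right_cancel h2).symm
    have hd' : Div F γ' = (pull Φ (inv (Base F σ)) z) ^ (k + 1) := by
      have h3 := congrArg (pull Φ (inv (Base F σ))) h1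
      rwa [← pull_comp, IsIso.inv_hom_id, pull_id, map_pow] at h3
    have hbij : Function.Bijective (pull Φ (inv (Base F σ))) :=
      ⟨pull_injective_of_isIso Φ _, fun y => ⟨pull Φ (inv (inv (Base F σ))) y, pull_pull_inv Φ _ y⟩⟩
    have hz' : IsIrreducibleElt (pull Φ (inv (Base F σ)) z) :=
      (isIrreducibleElt_map_iff _ hbij _).mpr hz
    have hch : IsFSMIChain γ' (k + 1) := ih γ' _ hz' hγ'.2 hd'
    rw [← hfac]
    exact IsFSMIChain.cons _ _ _
      (isFSMI_of_isPreStep_of_isIrreducibleElt F hF hist hσ.2 (hσz ▸ hz)) hch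

/-- **Prop. 1.14 (iii), repaired (R1)**: in a Frobenioid of isotropic type over a base category
of FSMFF-type IN WHICH PRIME-FROBENIUS MORPHISMS ARE FSMI-MORPHISMS, an irreducible `φ` is a
non-pre-step iff there is an `N` bounding the length of every expression of `ψ ∘ φ` (`ψ` an
FSMI-morphism) as a composite of FSMI-morphisms ("⟸" by the printed argument, p. 42).
[cite: MochizukiFrdI2008, Prop. 1.14(iii) p.41] -/
theorem not_isPreStep_iff_chain_bound_of_fsmi (hF : IsFrobenioid F) (hist : IsOfIsotropicType F)
    (hD : IsOfFSMFFType D) (H : ∀ {X Y : C} (ψ : X ⟶ Y), IsPrimeFrobenius F ψ → IsFSMI ψ)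
    {A B : C} {φ : A ⟶ B} (hirr : IsIrreducibleHom φ) :
    ¬ IsPreStep F φ ↔
      ∃ N : ℕ, ∀ ⦃B' : C⦄ (ψ : B ⟶ B') (n : ℕ), IsFSMI ψ → IsFSMIChain (φ ≫ ψ) n → n ≤ N := by
  refine ⟨exists_chain_bound_of_not_isPreStep F hF hist hD hirr, fun ⟨N, hN⟩ hps => ?_⟩
  -- `φ` is a step with irreducible zero divisor `x`
  have hx := isIrreducibleElt_div_of_isIrreducibleHom F hF hist hps hirr
  -- a prime `p > N` and a prime-Frobenius `ψ : B → B'` of degree `p`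
  obtain ⟨p, hNp, hp⟩ := Nat.exists_infinite_primes (N + 1)
  obtain ⟨B', ψ, hψ, hψd⟩ := hF.ii_exists B ⟨p, hp.pos⟩
  have hψpf : IsPrimeFrobenius F ψ := ⟨hψ, by rw [hψd]; exact hp⟩
  -- Prop. 1.10 (ii): `ψ ∘ φ = φ' ∘ ψ'`
  obtain ⟨A', ψ', φ', hψ', hφ', hsw, hdeg', hdiv'⟩ :=
    exists_frobeniusType_preStep_swap hF φ hps ψ hψ
  haveI : IsIso (Base F ψ') := hψ'.2
  have hψ'pf : IsPrimeFrobenius F ψ' := ⟨hψ', by rw [hdeg', hψd]; exact hp⟩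
  -- `Div(φ') = (ψ'_* x) ^ p` with `ψ'_* x` irreducible: `φ'` is a chain of `p` FSMI-morphisms
  have hbij : Function.Bijective (pull Φ (inv (Base F ψ'))) :=
    ⟨pull_injective_of_isIso Φ _, fun y => ⟨pull Φ (inv (inv (Base F ψ'))) y, pull_pull_inv Φ _ y⟩⟩
  have hz : IsIrreducibleElt (pull Φ (inv (Base F ψ')) (Div F φ)) :=
    (isIrreducibleElt_map_iff _ hbij _).mpr hx
  obtain ⟨k, hk⟩ : ∃ k, p = k + 1 := ⟨p - 1, (Nat.sub_add_cancel hp.pos).symm⟩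
  have hchain : IsFSMIChain φ' (k + 1) := by
    refine isFSMIChain_of_div_eq_pow F hF hist k φ' _ hz hφ' ?_
    rw [hdiv', hψd, ← hk]
    rfl
  have hlong : IsFSMIChain (φ ≫ ψ) (k + 1 + 1) := by
    rw [← hsw]
    exact IsFSMIChain.cons _ _ _ (H ψ' hψ'pf) hchain
  have := hN ψ (k + 1 + 1) (H ψ hψpf) hlong
  omega

/-- The repaired reading (R1) `NonPreStepIffBoundedFSMIChainsOfFSMI` of Prop. 1.14 (iii) HOLDS.
[cite: MochizukiFrdI2008, Prop. 1.14(iii) p.41] -/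
theorem nonPreStepIffBoundedFSMIChainsOfFSMI_holds : NonPreStepIffBoundedFSMIChainsOfFSMI.{w, v, v', u, u'} := by
  intro D _ Φ C _ F hF hist hD H A B φ hirr
  exact not_isPreStep_iff_chain_bound_of_fsmi F hF hist hD H hirr

end PreFrobenioid

end Literature.AlgebraicGeometry.Frobenioids
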